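import Summits.BirchSwinnertonDyer.BirchSwinnertonDyer.Theorems.ByReductionTypeAtTwoMultTransportIsogenyImageTypeFlip
import Summits.BirchSwinnertonDyer.BirchSwinnertonDyer.Theorems.ByReductionTypeAtTwoMultTransportIsogenyQuotientExists
import Summits.BirchSwinnertonDyer.BirchSwinnertonDyer.Theorems.TwoAdicConverseFullTwoTorsionNeitherSemistable
import HarnessLib

/-!
# T-42-mult in the kernel, CVI — road (S-C′), the UNIFORM theorem (chain induction), piece 2: THE DESCENT STEP AND THE DICHOTOMY —
# quotient by a type-A rational point of order `2` (dual, kernel, degree `2`, reduction type of the quotient, and the type flip for EVERY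
# image of the `2`-torsion, as RATIONAL points), then «unique rational `2`-torsion, or a type-A rational point» at the quotient by VIETA

Cell `bsd-2adic` (run/shared/lean/pub/bsd-2adic/), seat `bsd-2adic-t42` GEN 35 (pen RC-546/548 SUMMON; director-bsd (492); memo
`t42/DESIGN-T42-ADDENDUM-39.md`). HONEST FRAMING: research route; THEOREMS ONLY (no `def`, no named fact, no instance, no `sorry`); nothing
booked; no door or class file of the mult lane is touched or re-pointed (k6); BSD is not proved by any of this. PARTITION: X5@2 multiplicative
GV-transport rows (K4ᵐ B1·O1; items 19922 / 19923) × p = 2 — reduces-the-named-input-of (the side condition `hB` / the certificate of XCII–XCVIII);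
bears_on K4 (`--supports stmt-BirchSwinnertonDyer-19923`). Consumed by CVII `…OfMazurKenku` (the chain induction and ★★ the uniform transport).

## What

* §1 `exists_eq_toGeomPoints_of_fixed_twoTorsion` (Galois descent of a non-zero `Γ_ℚ`-fixed point of order `2` to a rational `(e, f)` with
  `2f + a₁e + a₃ = 0`), `toGeomPoints_add_self_eq_zero`, `exists_twoTorsion_ne_ne` (`#E[2] = 4`), `hasRationalTwoTorsionX_third` (two rational
  points of order `2` give the third, of a third abscissa).
* §2 **`descent_step`** — for `V` globally minimal, multiplicative or good ordinary at `2`, and a TYPE-A rational point `P = (a, b)` of order `2`: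
  the globally minimal quotient `φ : V → V′ = V/⟨P⟩` (C `exists_twoIsogeny_quotient`) with its dual `ψ` (`ψφ = [2]`), `ker φ ⊆ {O, P}`,
  `deg φ = 2`, `V′` again multiplicative / good ordinary at `2` (tree `mult_or_ord_of_isIsogenous`), and THE FLIP: every `R ∈ V(ℚ̄)` with
  `R + R = O`, `φ(R) ≠ O` has `φ(R) = (e, f)` RATIONAL (it is `Γ_ℚ`-fixed as `σR ∈ {R, R + P}`) of TYPE B (CV
  `not_twoTorsionRamifiedAtTwo_of_twoIsogeny_apply_eq`).
* §3 **`hasUniqueRationalTwoTorsionX_or_exists_ramified`** — on such a `V` a TYPE-B rational point `(e, f)` of order `2` is either the ONLY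
  rational point of order `2`, or `V` carries a TYPE-A rational point of order `2`: a second point gives a third (§1); `a₁` is odd on the
  minimal equation at a multiplicative / good ordinary `2` (tree `odd_a₁_integralModelInt_of_goodOrd_or_mult`), so by Vieta
  `4(x₁ + x₂ + x₃) = −b₂` one abscissa has `v₂ < 0` (tree `exists_twoTorsionRamifiedAtTwo_of_fullTwoTorsion_of_odd_a₁`), and it is not `e`.

References: [SilvermanAEC2009] III.2.3, Prop. III.4.12, Thm. III.6.1, Cor. III.6.4 (b), VII.7.2, VIII.1, Exercise 8.15 (a); [GreenbergVatsal2000] §2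
pp. 14–16, p. 28; [GreenbergLNM1716] §5 pp. 168–176, Prop. 5.14.
-/

set_option autoImplicit false
set_option linter.dupNamespace false

noncomputable section

open scoped Classical MatrixGroups ModularForm AddSubgroup

namespace Summit.BirchSwinnertonDyer.BirchSwinnertonDyer.Theorems.MultTransportAtTwo

open CongruenceSubgroup WeierstrassCurve Field Literature.NumberTheory.EllipticCurves
  Literature.NumberTheory.EllipticCurves.ModularForms Literature.NumberTheory.EllipticCurves.Wuthrich2014
  Literature.NumberTheory.EllipticCurves.Rank1Residual Literature.NumberTheory.EllipticCurves.Rank1Residual.Typed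
  Literature.NumberTheory.EllipticCurves.Greenberg1999 Literature.NumberTheory.EllipticCurves.GreenbergVatsal2000
  Literature.NumberTheory.EllipticCurves.Matsuno2008 Literature.NumberTheory.EllipticCurves.Kato2004
  Literature.NumberTheory.EllipticCurves.TateCurve Literature.NumberTheory.Transcendental
  Literature.NumberTheory.IwasawaTheory.Greenberg2006 Literature.NumberTheory.IwasawaTheory.Greenberg2016
  Literature.NumberTheory.GaloisCohomology
  Summit.BirchSwinnertonDyer.Rank1Residual Summit.BirchSwinnertonDyer.Rank1Residual.X1.MuLambda
  Summit.BirchSwinnertonDyer.Rank1Residual.X1.MuPart Summit.BirchSwinnertonDyer.Rank1Residual.X1.ParitySqueeze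
  Summit.BirchSwinnertonDyer.Rank1Residual.X2
  Summit.BirchSwinnertonDyer.Rank1Residual.X5.O1
  Summit.BirchSwinnertonDyer.BirchSwinnertonDyer.Theorems.MultKatoInputs
  Summit.BirchSwinnertonDyer.BirchSwinnertonDyer.Theorems.MultKatoRat
  Summit.BirchSwinnertonDyer.BirchSwinnertonDyer.Theorems.MultTransportTwistedDescent
  Summit.BirchSwinnertonDyer.BirchSwinnertonDyer.Theorems.InputsGreenbergVatsalLocalConditionAtP

/-! ## §1. Rational points of order `2`: Galois descent, a point off a pair, the third point -/

section TwoTorsion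

variable (V : WeierstrassCurve ℚ) [V.IsElliptic]

/-- **Galois descent of a fixed point of order `2`.** A non-zero `Γ_ℚ`-fixed `T ∈ E(ℚ̄)` with `T + T = O` is the rational affine point
`(e, f)` for some `e, f ∈ ℚ` with `2f + a₁e + a₃ = 0` (tree `exists_toGeomPoints_eq_of_forall_smul_eq`, *AEC* VIII.1; the ordinate condition
from `P = −P`, *AEC* III.2.3). [cite: SilvermanAEC2009, VIII.1 (proof of Prop. 1.2) and III.2.3] -/
theorem exists_eq_toGeomPoints_of_fixed_twoTorsion {T : V.geomPoints} (hT0 : T ≠ 0) (hT2 : T + T = 0)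
    (hfix : ∀ σ : absoluteGaloisGroup ℚ, σ • T = T) :
    ∃ (e f : ℚ) (hef : V.toAffine.Nonsingular e f), 2 * f + V.a₁ * e + V.a₃ = 0 ∧ T = toGeomPoints V (.some e f hef) := by
  obtain ⟨T₀, hT₀⟩ := exists_toGeomPoints_eq_of_forall_smul_eq V hfix
  rcases T₀ with _ | ⟨e, f, hef⟩
  · exact absurd (by rw [← hT₀]; rfl) hT0
  · -- `T = (e, f)` read in `ℚ̄`
    have hef' : (V.baseChange (AlgebraicClosure ℚ)).toAffine.Nonsingular (e : AlgebraicClosure ℚ) (f : AlgebraicClosure ℚ) := by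
      have h := WeierstrassCurve.Affine.Equation.map (algebraMap ℚ (AlgebraicClosure ℚ))
        ((WeierstrassCurve.Affine.equation_iff_nonsingular).mpr hef)
      simp only [eq_ratCast] at h
      exact (WeierstrassCurve.Affine.equation_iff_nonsingular).mp h
    have hTe : T = .some (e : AlgebraicClosure ℚ) (f : AlgebraicClosure ℚ) hef' := by
      rw [← hT₀]
      exact some_eq_some_geomPoints V (X₁ := algebraMap ℚ (AlgebraicClosure ℚ) e) (Y₁ := algebraMap ℚ (AlgebraicClosure ℚ) f)
        (h₁ := (WeierstrassCurve.Affine.baseChange_nonsingular (W := V.toAffine) (Algebra.ofId ℚ (AlgebraicClosure ℚ)).injective ..).mpr hef)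
        (eq_ratCast _ e) (eq_ratCast _ f)
    obtain ⟨hfe, -⟩ := two_torsion_coords_geomPoints V hTe hT2
    have hfe' : 2 * f + V.a₁ * e + V.a₃ = 0 := by
      have h' : ((2 * f + V.a₁ * e + V.a₃ : ℚ) : AlgebraicClosure ℚ) = 0 := by push_cast; exact hfe
      exact_mod_cast h'
    exact ⟨e, f, hef, hfe', hT₀.symm⟩

/-- **A rational point of order `2`, doubled in `E(ℚ̄)`, is `O`** (the image under `E(ℚ) → E(ℚ̄)` of `(a, b)` with `2b + a₁a + a₃ = 0` lies in
`E[2](ℚ̄)`; tree `exists_geomTorsion_two_of_hasRationalTwoTorsionX`). [cite: SilvermanAEC2009, III.2.3] -/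
theorem toGeomPoints_add_self_eq_zero {a b : ℚ} (hab : V.toAffine.Nonsingular a b) (h2 : 2 * b + V.a₁ * a + V.a₃ = 0) :
    toGeomPoints V (.some a b hab) + toGeomPoints V (.some a b hab) = 0 := by
  obtain ⟨b₁, h₁, P₁, hP₁, -, -, h2₁⟩ := exists_geomTorsion_two_of_hasRationalTwoTorsionX V ⟨b,
    (WeierstrassCurve.Affine.equation_iff_nonsingular).mpr hab, h2⟩
  obtain rfl : b₁ = b := by linarith
  have hP₁g : (P₁ : V.geomPoints) = toGeomPoints V (.some a b₁ hab) := by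
    rw [hP₁]
    exact (some_eq_some_geomPoints V (X₁ := algebraMap ℚ (AlgebraicClosure ℚ) a) (Y₁ := algebraMap ℚ (AlgebraicClosure ℚ) b₁)
      (h₁ := (WeierstrassCurve.Affine.baseChange_nonsingular (W := V.toAffine) (Algebra.ofId ℚ (AlgebraicClosure ℚ)).injective ..).mpr hab)
      (eq_ratCast _ a) (eq_ratCast _ b₁)).symm
  rw [← hP₁g, ← AddSubgroup.coe_add, add_self_geomTorsion_two V P₁, ZeroMemClass.coe_zero]

/-- **A point of `E[2](ℚ̄)` off `{O, P₀}`** for any `P₀` of order dividing `2` (`#E[2] = 4`, *AEC* III.6.4 (b), tree `natCard_geomTorsion_two`).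
[cite: SilvermanAEC2009, Cor. III.6.4 (b)] -/
theorem exists_twoTorsion_ne_ne {P₀ : V.geomPoints} (hP₀2 : P₀ + P₀ = 0) :
    ∃ Q : V.geomPoints, Q + Q = 0 ∧ Q ≠ 0 ∧ Q ≠ P₀ := by
  by_contra hnone
  push Not at hnone
  have hsurj : Function.Surjective (fun b : Bool ↦ if b then (⟨P₀, by
      rw [WeierstrassCurve.mem_geomTorsion_iff, two_zsmul]; exact hP₀2⟩ : V.geomTorsion 2) else 0) := by
    intro T
    have hT2 : (T : V.geomPoints) + T = 0 := by
      rw [← AddSubgroup.coe_add, add_self_geomTorsion_two V T, ZeroMemClass.coe_zero]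
    by_cases hT0 : (T : V.geomPoints) = 0
    · exact ⟨false, Subtype.ext (by simpa using hT0.symm)⟩
    · exact ⟨true, Subtype.ext (by simpa using (hnone T hT2 hT0).symm)⟩
  have hle := Nat.card_le_card_of_surjective _ hsurj
  rw [MultTransportAtTwo.natCard_geomTorsion_two V, Nat.card_eq_fintype_card, Fintype.card_bool] at hle
  omega

/-- **Two rational points of order `2` give the third**: if `e ≠ z` are abscissae of rational points of order `2`, the sum of those points
in `E(ℚ̄)` is a non-zero `Γ_ℚ`-fixed point of order `2`, hence a third rational point of order `2`, of abscissa `w ∉ {e, z}` (a point of order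
`2` is determined by its abscissa). [cite: SilvermanAEC2009, III.2.3 and VIII.1] -/
theorem hasRationalTwoTorsionX_third {e z : ℚ} (he : HasRationalTwoTorsionX V e) (hz : HasRationalTwoTorsionX V z) (hne : e ≠ z) :
    ∃ w : ℚ, HasRationalTwoTorsionX V w ∧ w ≠ e ∧ w ≠ z := by
  obtain ⟨f, hf, R₁, hR₁, hR₁0, hR₁fix, h2f⟩ := exists_geomTorsion_two_of_hasRationalTwoTorsionX V he
  obtain ⟨y, hy, R₂, hR₂, hR₂0, hR₂fix, h2y⟩ := exists_geomTorsion_two_of_hasRationalTwoTorsionX V hz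
  -- abscissa comparison: equal points of `E[2](ℚ̄)` with rational coordinates have equal rational abscissae
  have hX : ∀ {e₁ f₁ e₂ f₂ : ℚ} {h₁ : (V.baseChange (AlgebraicClosure ℚ)).toAffine.Nonsingular (e₁ : AlgebraicClosure ℚ) (f₁ : AlgebraicClosure ℚ)}
      {h₂ : (V.baseChange (AlgebraicClosure ℚ)).toAffine.Nonsingular (e₂ : AlgebraicClosure ℚ) (f₂ : AlgebraicClosure ℚ)},
      (Affine.Point.some _ _ h₁ : V.geomPoints) = Affine.Point.some _ _ h₂ → e₁ = e₂ := by
    intro e₁ f₁ e₂ f₂ h₁ h₂ h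
    injection h with h1
    exact_mod_cast h1
  have h12 : R₁ ≠ R₂ := fun h ↦ hne (hX (hR₁ ▸ hR₂ ▸ congrArg Subtype.val h))
  have hR₃0 : R₁ + R₂ ≠ 0 := by
    intro h
    apply h12
    rw [eq_neg_of_add_eq_zero_left h]
    exact neg_eq_iff_add_eq_zero.mpr (add_self_geomTorsion_two V R₂)
  have hR₃fix : ∀ σ : absoluteGaloisGroup ℚ, σ • (R₁ + R₂) = R₁ + R₂ := fun σ ↦ by
    rw [smul_add, hR₁fix σ, hR₂fix σ]
  have hR₃2 : ((R₁ + R₂ : V.geomTorsion 2) : V.geomPoints) + (R₁ + R₂ : V.geomTorsion 2) = 0 := by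
    rw [← AddSubgroup.coe_add, add_self_geomTorsion_two V (R₁ + R₂), ZeroMemClass.coe_zero]
  have hR₃0' : ((R₁ + R₂ : V.geomTorsion 2) : V.geomPoints) ≠ 0 := fun h ↦ hR₃0 (Subtype.ext h)
  have hR₃fix' : ∀ σ : absoluteGaloisGroup ℚ, σ • ((R₁ + R₂ : V.geomTorsion 2) : V.geomPoints) = (R₁ + R₂ : V.geomTorsion 2) :=
    fun σ ↦ by rw [← AddSubgroup.torsionBy.coe_smul, hR₃fix σ]
  obtain ⟨w, yw, hw, h2w, hR₃w⟩ := exists_eq_toGeomPoints_of_fixed_twoTorsion V hR₃0' hR₃2 hR₃fix'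
  -- the rational point `(w, yw)` read in `ℚ̄`
  have hw' : (V.baseChange (AlgebraicClosure ℚ)).toAffine.Nonsingular (w : AlgebraicClosure ℚ) (yw : AlgebraicClosure ℚ) := by
    have h := WeierstrassCurve.Affine.Equation.map (algebraMap ℚ (AlgebraicClosure ℚ))
      ((WeierstrassCurve.Affine.equation_iff_nonsingular).mpr hw)
    simp only [eq_ratCast] at h
    exact (WeierstrassCurve.Affine.equation_iff_nonsingular).mp h
  have hR₃e : ((R₁ + R₂ : V.geomTorsion 2) : V.geomPoints) = .some (w : AlgebraicClosure ℚ) (yw : AlgebraicClosure ℚ) hw' := by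
    rw [hR₃w]
    exact some_eq_some_geomPoints V (X₁ := algebraMap ℚ (AlgebraicClosure ℚ) w) (Y₁ := algebraMap ℚ (AlgebraicClosure ℚ) yw)
      (h₁ := (WeierstrassCurve.Affine.baseChange_nonsingular (W := V.toAffine) (Algebra.ofId ℚ (AlgebraicClosure ℚ)).injective ..).mpr hw)
      (eq_ratCast _ w) (eq_ratCast _ yw)
  refine ⟨w, ⟨yw, hw.left, h2w⟩, fun hwe ↦ hR₂0 ?_, fun hwz ↦ hR₁0 ?_⟩
  · -- `w = e`: then `(w, yw) = (e, f)`, so `R₁ + R₂ = R₁` and `R₂ = O`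
    subst hwe
    obtain rfl : yw = f := by linarith
    have h31 : R₁ + R₂ = R₁ := Subtype.ext (by rw [hR₃e, hR₁])
    simpa using h31
  · -- `w = z`: then `(w, yw) = (z, y)`, so `R₁ + R₂ = R₂` and `R₁ = O`
    subst hwz
    obtain rfl : yw = y := by linarith
    have h32 : R₁ + R₂ = R₂ := Subtype.ext (by rw [hR₃e, hR₂])
    simpa using h32

end TwoTorsion

/-! ## §2. The descent step: quotient by a type-A point, with the flip for every image of the `2`-torsion -/

/-- **The descent step.** `V/ℚ` globally minimal, multiplicative or good ordinary at `2`, `P = (a, b)` a rational point of order `2` of TYPE A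
(`TwoTorsionRamifiedAtTwo a`). Then there are a globally minimal elliptic `V′`, `φ : V → V′`, `ψ : V′ → V` with `ψ ∘ φ = [2]`, `φ(P) = O`,
`ker φ ⊆ {O, P}`, `deg φ = 2`, `V′` again multiplicative or good ordinary at `2` (*AEC* VII.7.2 / Faltings, tree), and THE FLIP: every
`R ∈ V(ℚ̄)` with `R + R = O` and `φ(R) ≠ O` has `φ(R) = (e, f)` a RATIONAL point of order `2` of TYPE B (`φ(R)` is `Γ_ℚ`-fixed since
`σR ∈ {R, R + P}`; Galois descent §1; CV). [cite: SilvermanAEC2009, Prop. III.4.12, Thm. III.6.1, VII.7.2, VIII.1]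
[cite: GreenbergVatsal2000, §2 pp. 14–16 and p. 28] [cite: GreenbergLNM1716, §5 p. 168 and p. 176] -/
theorem descent_step (κ : ZpExtension ℚ 2) (hκ : κ.IsCyclotomic)
    (V : WeierstrassCurve ℚ) [V.IsElliptic] [V.IsGloballyMinimal]
    (hred : V.HasMultiplicativeReductionAtPrime 2 ∨ IsOrdinaryAt V 2)
    {a b : ℚ} (hab : V.toAffine.Nonsingular a b) (h2 : 2 * b + V.a₁ * a + V.a₃ = 0) (hA : TwoTorsionRamifiedAtTwo a) :
    ∃ (V' : WeierstrassCurve ℚ) (_ : V'.IsElliptic) (_ : V'.IsGloballyMinimal) (φ : Isogeny V V') (ψ : Isogeny V' V),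
      (∀ R : V.geomPoints, ψ (φ R) = ((2 ^ 1 : ℕ) : ℤ) • R) ∧ φ (toGeomPoints V (.some a b hab)) = 0 ∧
      (∀ R : V.geomPoints, φ R = 0 → R = 0 ∨ R = toGeomPoints V (.some a b hab)) ∧ φ.degree = 2 ∧
      (V'.HasMultiplicativeReductionAtPrime 2 ∨ IsOrdinaryAt V' 2) ∧
      ∀ R : V.geomPoints, R + R = 0 → φ R ≠ 0 →
        ∃ (e f : ℚ) (hef : V'.toAffine.Nonsingular e f), 2 * f + V'.a₁ * e + V'.a₃ = 0 ∧
          φ R = toGeomPoints V' (.some e f hef) ∧ ¬ TwoTorsionRamifiedAtTwo e := by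
  haveI : Fact (Nat.Prime 2) := ⟨Nat.prime_two⟩
  obtain ⟨V', hV', hV'min, φ, ψ, h1, hφ0, hφker⟩ := exists_twoIsogeny_quotient V hab h2
  haveI := hV'
  haveI := hV'min
  set P : V.geomPoints := toGeomPoints V (.some a b hab) with hPdef
  have hPne : P ≠ 0 := by
    rw [hPdef]
    intro h
    exact WeierstrassCurve.Affine.Point.some_ne_zero hab (toGeomPoints_injective V (by rw [h, map_zero]))
  have hP2 : P + P = 0 := toGeomPoints_add_self_eq_zero V hab h2
  -- `deg φ = 2`
  have hdeg : φ.degree = 2 := by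
    have hset : (φ.toAddMonoidHom.ker : Set V.geomPoints) = {0, P} := by
      ext R
      simp only [SetLike.mem_coe, AddMonoidHom.mem_ker, Set.mem_insert_iff, Set.mem_singleton_iff]
      exact ⟨hφker R, by rintro (rfl | rfl); exacts [map_zero _, hφ0]⟩
    unfold Isogeny.degree
    rw [← SetLike.coe_sort_coe, hset, Nat.card_coe_set_eq, Set.ncard_pair hPne.symm]
  have hredV' : V'.HasMultiplicativeReductionAtPrime 2 ∨ IsOrdinaryAt V' 2 := mult_or_ord_of_isIsogenous V V' ⟨φ⟩ hred
  refine ⟨V', hV', hV'min, φ, ψ, h1, hφ0, hφker, hdeg, hredV', fun R hR2 hR0 ↦ ?_⟩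
  -- `φ R` has order `2` and is `Γ_ℚ`-fixed
  have hφR2 : φ R + φ R = 0 := by rw [← map_add, hR2, map_zero]
  have hfix : ∀ τ : absoluteGaloisGroup ℚ, τ • φ R = φ R := by
    intro τ
    let Rt : V.geomTorsion 2 := ⟨R, by rw [WeierstrassCurve.mem_geomTorsion_iff, two_zsmul]; exact hR2⟩
    let Pt : V.geomTorsion 2 := ⟨P, by rw [WeierstrassCurve.mem_geomTorsion_iff, two_zsmul]; exact hP2⟩
    have hPt0 : Pt ≠ 0 := fun h ↦ hPne (congrArg Subtype.val h)
    have hPtfix : ∀ σ : absoluteGaloisGroup ℚ, σ • Pt = Pt := fun σ ↦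
      Subtype.ext (by rw [AddSubgroup.torsionBy.coe_smul]; exact smul_toGeomPoints V σ _)
    rw [← φ.map_smul]
    rcases smul_eq_self_or_eq_add V hPt0 hPtfix τ Rt with h | h
    · exact congrArg φ (congrArg Subtype.val h :)
    · have h' : τ • R = R + P := congrArg Subtype.val h
      rw [h', map_add, hφ0, add_zero]
  obtain ⟨e, f, hef, h2f, hφRe⟩ := exists_eq_toGeomPoints_of_fixed_twoTorsion V' hR0 hφR2 hfix
  exact ⟨e, f, hef, h2f, hφRe,
    not_twoTorsionRamifiedAtTwo_of_twoIsogeny_apply_eq V V' κ hκ hred hab h2 hA φ hφ0 hφker hR2 hef h2f hφRe⟩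

/-! ## §3. The dichotomy at a vertex carrying a type-B rational point of order `2` -/

/-- **Unique rational `2`-torsion, or a type-A rational point of order `2`.** On a globally minimal `V`, multiplicative or good ordinary at `2`,
with a rational point `(e, f)` of order `2` of TYPE B: either `(e, f)` is the ONLY rational point of order `2`, or `V` has a rational point of
order `2` of TYPE A (a second point gives a third, §1; `a₁` is odd on the minimal equation, so by Vieta `4(x₁ + x₂ + x₃) = −b₂` one of the
three abscissae has `v₂ < 0` — tree `exists_twoTorsionRamifiedAtTwo_of_fullTwoTorsion_of_odd_a₁`; it is not `e`).
[cite: GreenbergLNM1716, §5 p. 170 (C₂[2] ≠ 0) and Prop. 5.14] [cite: SilvermanAEC2009, III.2.3, Exercise 8.15 (a)] -/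
theorem hasUniqueRationalTwoTorsionX_or_exists_ramified (V : WeierstrassCurve ℚ) [V.IsElliptic] [V.IsGloballyMinimal]
    (hred : V.HasMultiplicativeReductionAtPrime 2 ∨ IsOrdinaryAt V 2)
    {e f : ℚ} (hef : V.toAffine.Nonsingular e f) (h2 : 2 * f + V.a₁ * e + V.a₃ = 0) (hB : ¬ TwoTorsionRamifiedAtTwo e) :
    HasUniqueRationalTwoTorsionX V e ∨
      ∃ (a b : ℚ) (_ : V.toAffine.Nonsingular a b), 2 * b + V.a₁ * a + V.a₃ = 0 ∧ TwoTorsionRamifiedAtTwo a := by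
  haveI : Fact (Nat.Prime 2) := ⟨Nat.prime_two⟩
  have he : HasRationalTwoTorsionX V e := ⟨f, hef.left, h2⟩
  by_cases huniq : ∀ z : ℚ, HasRationalTwoTorsionX V z → z = e
  · exact Or.inl ⟨he, huniq⟩
  · right
    push Not at huniq
    obtain ⟨z, hz, hze⟩ := huniq
    obtain ⟨w, hw, hwe, hwz⟩ := hasRationalTwoTorsionX_third V he hz (Ne.symm hze)
    have hred' : GoodOrd V 2 ∨ Mult V 2 := hred.symm.imp (fun h ↦ h) (fun h ↦ h)
    have ha₁ := odd_a₁_integralModelInt_of_goodOrd_or_mult V hred'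
    have hram : TwoTorsionRamifiedAtTwo z ∨ TwoTorsionRamifiedAtTwo w := by
      rcases TwoAdicOffHabitat.exists_twoTorsionRamifiedAtTwo_of_fullTwoTorsion_of_odd_a₁ V ha₁ (Ne.symm hze) (Ne.symm hwe)
        (Ne.symm hwz) he hz hw with h | h | h
      · exact absurd h hB
      · exact Or.inl h
      · exact Or.inr h
    rcases hram with h | h
    · obtain ⟨y, hEq, h2y⟩ := hz
      exact ⟨z, y, (WeierstrassCurve.Affine.equation_iff_nonsingular).mp hEq, h2y, h⟩
    · obtain ⟨y, hEq, h2y⟩ := hw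
      exact ⟨w, y, (WeierstrassCurve.Affine.equation_iff_nonsingular).mp hEq, h2y, h⟩

end Summit.BirchSwinnertonDyer.BirchSwinnertonDyer.Theorems.MultTransportAtTwo

end
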